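import Summits.BirchSwinnertonDyer.BirchSwinnertonDyer.Theorems.CongruentShaFreeCutKatoDescentRealisable
import Literature.NumberTheory.EllipticCurves.IwasawaAlgebraRankOneIdealProofs
import Literature.NumberTheory.EllipticCurves.BSDAnalyticRank
import HarnessLib

set_option linter.dupNamespace false
set_option autoImplicit false

/-! # Reading (R+K) of the Kato–zeta road is a THEOREM modulo Kato's three construction facts:
# `readingRK_of_facts` — a v2-PINNED Kato descent datum satisfying the «main-conjecture-type» relation
# `∃ a b, (p^a)·char(H2) = (p^b)·char(H ⧸ Λz)` EXISTS, for every elliptic `W/ℚ` and every prime `p`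

Cell `bsd-cn100`, typer seat `bsd-cn100-ty` (g8); plan g13 PARTITION FIX 2026-08-26T20:25:53Z («ty g8 OWNS
`readingRK`»). Helper for stmt-BirchSwinnertonDyer-19080 (and, being `W,p`-generic, for its S2b twin
stmt-BirchSwinnertonDyer-19160): the registered stub `stub_readingRK` of the line `kato-zeta-perrin-riou` (v1b,
19080 sha16 29620dc6ecebcde4 / 19160 sha16 45865bca9569c113) becomes an in-skeleton ONE-LINER over the
citation-borne conjuncts `nonempty_iwasawaH1Data ∧ nonempty_iwasawaH2Data ∧ thm12_4` of `stub_refereedInputs`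
(`readingRK_congruentNumberCurve_of_facts`, `readingRK_jZero_three_of_facts` below are the two registered shapes
token for token). THEOREMS ONLY; no definition, no named fact, no instance; no `Theses` import (build rule
2026-08-26T19:13:48Z (H)). PARTITION: none — RANK axis.

HONEST FRAMING. What is proved is Λ-MODULE ALGEBRA plus bookkeeping: by
`Literature/NumberTheory/EllipticCurves/IwasawaAlgebraRankOneIdealProofs.lean` (this seat, g8) a finitely
generated torsion-free `Λ`-module of rank one (`𝐇¹_Γ(T_pW)`, Kato Thm. 12.4 (2)) is an ideal of finite index in
`Λ`, so for the finitely generated torsion module `𝐇²_Γ(T_pW)` (Thm. 12.4 (1)) there is a CHOICE of `z ∈ 𝐇¹_Γ`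
with `char(𝐇¹_Γ ⧸ Λz) = (p^N)·char(𝐇²_Γ)`. The relation «`∃ a b, (p^a)·char(D.H2) = (p^b)·char(D.H ⧸ Λ D.z)`»
in the road's hypothesis `hRK` is therefore satisfiable BY CONSTRUCTION — it is Kato's Main Conjecture 12.10
(Burungale–Tian 2026 Thm. 2.6 / [ABS] Thm. 10.6) only for Kato's GENUINE zeta element `𝐳_γ`, which the v2 pin
deliberately does not pin (docstring of `IsKatoDescentDatumOfH2`; s2-c3 g7 junk-safety note 2026-08-26T19:26:02Z:
the research content of the line sits in `PRFormulaAtTwoH2`, which quantifies over ALL pinned data with (K)).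
Nothing about Kato's Main Conjecture, crux B, the congruent number problem, Sylvester's problem or BSD is proved.

References: K. Kato, Astérisque 295 (2004), §12.2 (12.2.1) (p. 220), Thm. 12.4 (p. 221), Conj. 12.10 (p. 224),
13.14 (p. 234), §14.14 (14.14.1) (p. 243) [Kato2004Asterisque]; N. Bourbaki, *Algèbre commutative* VII §4
[BourbakiAC5to7]; tree: `Kato2004/IwasawaCohomology.lean` (`nonempty_iwasawaH1Data`, `thm12_4`; bsd-smallim),
`Kato2004/IwasawaH2Descent.lean` (`IwasawaH2Data`, `nonempty_iwasawaH2Data`; bsd-cn100-ty g7),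
`Theorems/CongruentShaFreeCutKatoDescentDatumOfH2.lean` (`KatoDescentDatumPinH2`; s2-c3 g7),
`Theorems/CongruentShaFreeCutKatoDescentRealisable.lean` (`noZeroSMulDivisors_of_isTorsionFree`, the (R)-only
realisability `exists_isKatoDescentDatumOfH2`; s2-c3 g7), `IwasawaAlgebraRankOneIdealProofs.lean` (this seat).
-/

noncomputable section

open scoped Classical

namespace Summit.BirchSwinnertonDyer.BirchSwinnertonDyer.Theorems.CongruentShaFreeCutKatoZetaRoadReadings

open WeierstrassCurve Field Literature.NumberTheory.EllipticCurves
  Literature.NumberTheory.EllipticCurves.Kato2004 Literature.NumberTheory.EllipticCurves.IwasawaAlgebra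
  Literature.NumberTheory.EllipticCurves.Kato2004.EulerSystemValues
  Literature.NumberTheory.GaloisRepresentations
open Summit.BirchSwinnertonDyer.Rank1Residual.Additive (KatoDescentDatum)
open Summit.BirchSwinnertonDyer.BirchSwinnertonDyer.Theorems.CongruentShaFreeCutKatoDescentDatumOfH2
open Summit.BirchSwinnertonDyer.BirchSwinnertonDyer.Theorems.CongruentShaFreeCutKatoDescentRealisable
  (noZeroSMulDivisors_of_isTorsionFree)

/-! ## §1 On a pair of packages: a pinned datum whose `z` realises the char-ideal relation -/

/-- **A v2-pinned descent datum with the «main-conjecture-type» relation, ON GIVEN PACKAGES.** From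
`I : IwasawaH1Data W p κ γ` with `I.H` finitely generated, torsion free of `Λ`-rank one (conclusions of
`Kato2004.thm12_4`) and a descent package `J : IwasawaH2Data W p κ γ I` (`J.H2 = 𝐇²_Γ` finitely generated torsion,
(14.14.1) on `J.A`), there is a bsd-potss datum `D` — `H := I.H`, `H2 := J.H2`, `A := J.A`, `ι := J.ι`, `π := J.π`,
and `z ∈ 𝐇¹_Γ` CHOSEN by `IwasawaAlgebra.exists_generator_span_pow_mul_charIdeal_eq` — with the identity v2 pin
and `∃ a b, (p^a)·char(D.H2) = (p^b)·char(D.H ⧸ Λ D.z)`. Module algebra over `Λ`; no arithmetic input.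
[cite: Kato2004Asterisque, Thm. 12.4 (p. 221), Conj. 12.10 (p. 224) and §14.14 (14.14.1) (p. 243)]
[cite: BourbakiAC5to7, Ch. VII §4 no. 2 and no. 5] -/
theorem exists_pin_charIdeal_rel_of_packages (W : WeierstrassCurve ℚ) [W.IsElliptic] (p : ℕ) [Fact p.Prime]
    [ContinuousSMul ℤ_[p] (W.tateModule p)] {κ : ZpExtension ℚ p} {γ : absoluteGaloisGroup ℚ}
    (hκ : κ.IsCyclotomic) (hγ : κ.IsTopGenerator γ) (I : IwasawaH1Data W p κ γ)
    (hfin : Module.Finite (IwasawaAlgebra p) I.H) (htf : Module.IsTorsionFree (IwasawaAlgebra p) I.H)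
    (hrk : Module.rank (IwasawaAlgebra p) I.H = 1) (J : IwasawaH2Data W p κ γ I) :
    ∃ D : KatoDescentDatum p, Nonempty (KatoDescentDatumPinH2 W p D) ∧
      ∃ a b : ℕ,
        Ideal.span {((p : ℕ) : IwasawaAlgebra p) ^ a} * Module.charIdeal (IwasawaAlgebra p) D.H2 =
          Ideal.span {((p : ℕ) : IwasawaAlgebra p) ^ b} *
            Module.charIdeal (IwasawaAlgebra p) (D.H ⧸ (IwasawaAlgebra p) ∙ D.z) := by
  haveI := hfin
  haveI := htf
  haveI : NoZeroSMulDivisors (IwasawaAlgebra p) I.H := noZeroSMulDivisors_of_isTorsionFree I.H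
  haveI := J.finite_H2
  obtain ⟨z, hz, htor, a, b, hab⟩ :=
    IwasawaAlgebra.exists_generator_span_pow_mul_charIdeal_eq (M := I.H) hrk J.H2
  let D : KatoDescentDatum p :=
    { H := I.H, z := z, z_ne_zero := hz, isTorsion_quotient := htor,
      H2 := J.H2, isTorsion_H2 := J.isTorsion_H2, A := J.A,
      ι := J.ι, π := J.π, ι_injective := J.ι_injective, π_surjective := J.π_surjective,
      exact_ι_π := J.exact_ι_π }
  refine ⟨D, ⟨?_⟩, a, b, hab⟩
  exact
    { κ := κ, isCyclotomic := hκ, γ := γ, isTopGenerator := hγ, I := I, J := J,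
      eH := LinearEquiv.refl _ _, eH2 := LinearEquiv.refl _ _, eA := LinearEquiv.refl _ _,
      eA_ι := fun _ ↦ rfl, eH2_π := fun _ ↦ rfl }

/-! ## §2 From Kato's three construction facts: reading (R+K) as typed, for every `W` and `p` -/

/-- **READING (R+K) OF THE KATO–ZETA ROAD, AS TYPED, FROM KATO'S CONSTRUCTION FACTS.** For every elliptic
`W/ℚ` and every prime `p`: granted bsd-smallim's `Kato2004.nonempty_iwasawaH1Data` [Kato (12.2.1), §13.8],
bsd-cn100-ty's `Kato2004.nonempty_iwasawaH2Data` [Kato Thm. 12.4 (1), (14.14.1)] and `Kato2004.thm12_4` [Kato Thm.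
12.4 (2)], there is `D : KatoDescentDatum p` with a v2 pin `KatoDescentDatumPinH2 W p D` AND
`∃ a b, (p^a)·char(D.H2) = (p^b)·char(D.H ⧸ Λ D.z)`. The cyclotomic `ℤ_p`-extension is the tree's
(`ZpExtension.exists_isCyclotomic_holds`), `γ` any preimage of `1`; `z` is CHOSEN (module algebra:
`IwasawaAlgebraRankOneIdealProofs`). CONDITIONAL on the three named facts; the char-ideal relation is realised by
the choice of `z`, so this is NOT Kato's Main Conjecture for the zeta element and proves nothing about it or BSD.
Argument order = the order of the conjuncts of the registered `stub_refereedInputs`.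
[cite: Kato2004Asterisque, §12.2 (12.2.1) (p. 220), Thm. 12.4 (p. 221), §14.14 (14.14.1) (p. 243)]
[cite: BourbakiAC5to7, Ch. VII §4 no. 2] -/
theorem readingRK_of_facts (h1 : nonempty_iwasawaH1Data) (h2 : nonempty_iwasawaH2Data) (h12 : thm12_4)
    (W : WeierstrassCurve ℚ) [W.IsElliptic] (p : ℕ) [Fact p.Prime] [ContinuousSMul ℤ_[p] (W.tateModule p)] :
    ∃ D : KatoDescentDatum p, Nonempty (KatoDescentDatumPinH2 W p D) ∧
      ∃ a b : ℕ,
        Ideal.span {((p : ℕ) : IwasawaAlgebra p) ^ a} * Module.charIdeal (IwasawaAlgebra p) D.H2 =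
          Ideal.span {((p : ℕ) : IwasawaAlgebra p) ^ b} *
            Module.charIdeal (IwasawaAlgebra p) (D.H ⧸ (IwasawaAlgebra p) ∙ D.z) := by
  obtain ⟨κ, hκ⟩ := ZpExtension.exists_isCyclotomic_holds ℚ p
    (GaloisRep.cyclotomicCharacter_range_infinite ℚ p)
  obtain ⟨γ, hγ⟩ := κ.surjective (Multiplicative.ofAdd 1)
  have hγ' : κ.IsTopGenerator γ := hγ
  obtain ⟨I⟩ := h1 W p κ γ hκ hγ'
  obtain ⟨hfin, ⟨htf, hrk⟩, -⟩ := h12 W p κ γ hκ hγ' I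
  obtain ⟨J⟩ := h2 W p κ γ hκ hγ' I
  exact exists_pin_charIdeal_rel_of_packages W p hκ hγ' I hfin htf hrk J

/-- The same with the tree's canonical instance `TateModule.continuousSMul_padicInt` supplied (no instance
binder). [cite: Kato2004Asterisque, Thm. 12.4 (p. 221) and §14.14 (14.14.1) (p. 243)] -/
theorem readingRK_of_facts' (h1 : nonempty_iwasawaH1Data) (h2 : nonempty_iwasawaH2Data) (h12 : thm12_4)
    (W : WeierstrassCurve ℚ) [W.IsElliptic] (p : ℕ) [Fact p.Prime] :
    ∃ D : KatoDescentDatum p,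
      Nonempty (@KatoDescentDatumPinH2 W _ p _ TateModule.continuousSMul_padicInt D) ∧
      ∃ a b : ℕ,
        Ideal.span {((p : ℕ) : IwasawaAlgebra p) ^ a} * Module.charIdeal (IwasawaAlgebra p) D.H2 =
          Ideal.span {((p : ℕ) : IwasawaAlgebra p) ^ b} *
            Module.charIdeal (IwasawaAlgebra p) (D.H ⧸ (IwasawaAlgebra p) ∙ D.z) :=
  letI : ContinuousSMul ℤ_[p] (W.tateModule p) := TateModule.continuousSMul_padicInt
  readingRK_of_facts h1 h2 h12 W p

/-! ## §3 The two registered shapes (token for token): S2 (`E_n`, `p = 2`) and S2b (`j = 0`, `p = 3`) -/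

/-- **`stub_readingRK` of stmt-BirchSwinnertonDyer-19080 (line `kato-zeta-perrin-riou` v1b), verbatim, from the three
construction facts** — the in-skeleton proof is `readingRK_congruentNumberCurve_of_facts RI₇ RI₈ RI₉` with
`RIₖ` the `k`-th conjunct of `stub_refereedInputs`. [cite: Kato2004Asterisque, Thm. 12.4 (p. 221) and §14.14 (14.14.1) (p. 243)] -/
theorem readingRK_congruentNumberCurve_of_facts (h1 : nonempty_iwasawaH1Data) (h2 : nonempty_iwasawaH2Data)
    (h12 : thm12_4) :
    ∀ ⦃n : ℕ⦄, Squarefree n →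
      ∀ [(congruentNumberCurve n).IsElliptic] [(congruentNumberCurve n).IsGloballyMinimal]
        [ContinuousSMul ℤ_[2] ((congruentNumberCurve n).tateModule 2)],
        ∃ D : KatoDescentDatum 2, Nonempty (KatoDescentDatumPinH2 (congruentNumberCurve n) 2 D) ∧
          ∃ a b : ℕ,
            Ideal.span {((2 : ℕ) : IwasawaAlgebra 2) ^ a} * Module.charIdeal (IwasawaAlgebra 2) D.H2 =
              Ideal.span {((2 : ℕ) : IwasawaAlgebra 2) ^ b} *
                Module.charIdeal (IwasawaAlgebra 2) (D.H ⧸ (IwasawaAlgebra 2) ∙ D.z) :=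
  fun n _ _ _ _ ↦ readingRK_of_facts h1 h2 h12 (congruentNumberCurve n) 2

/-- **`stub_readingRK` of stmt-BirchSwinnertonDyer-19160 (S2b twin, line `kato-zeta-perrin-riou` v1b), verbatim, from the
three construction facts** (the hypotheses `IsGloballyMinimal`, `j = 0` are not used).
[cite: Kato2004Asterisque, Thm. 12.4 (p. 221) and §14.14 (14.14.1) (p. 243)] -/
theorem readingRK_jZero_three_of_facts (h1 : nonempty_iwasawaH1Data) (h2 : nonempty_iwasawaH2Data)
    (h12 : thm12_4) :
    ∀ (W : WeierstrassCurve ℚ) [W.IsElliptic] [W.IsGloballyMinimal]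
      [ContinuousSMul ℤ_[3] (W.tateModule 3)], W.j = 0 →
        ∃ D : KatoDescentDatum 3, Nonempty (KatoDescentDatumPinH2 W 3 D) ∧
          ∃ a b : ℕ,
            Ideal.span {((3 : ℕ) : IwasawaAlgebra 3) ^ a} * Module.charIdeal (IwasawaAlgebra 3) D.H2 =
              Ideal.span {((3 : ℕ) : IwasawaAlgebra 3) ^ b} *
                Module.charIdeal (IwasawaAlgebra 3) (D.H ⧸ (IwasawaAlgebra 3) ∙ D.z) :=
  fun W _ _ _ _ ↦ readingRK_of_facts h1 h2 h12 W 3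

end Summit.BirchSwinnertonDyer.BirchSwinnertonDyer.Theorems.CongruentShaFreeCutKatoZetaRoadReadings

end
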